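import Literature.AlgebraicGeometry.Resolution.DecompositionLayerFrame
import Literature.AlgebraicGeometry.Resolution.NormalModels
import Literature.AlgebraicGeometry.Resolution.NormalBirationalQuasiFinite
import Mathlib.RingTheory.EssentialFiniteness
import HarnessLib

/-!
# [CoP1] Prop. 9.3, decomposition layer: "By (52) and Zariski's Main Theorem, `R` lies below `S′`", in the frame

Topic: `Literature/AlgebraicGeometry/Resolution`. PROOF side of `CossartPiltant2019ReductionP`
(`ArithmeticalThreefoldsLocal.lean`), input (C4), hypothesis `hDec` of
`cossartPiltant2019ReductionP_of_cjs_of_stableInertiaHensel` ([CoP1] Prop. 9.3, decomposition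
layer). Zariski's Main Theorem in the currency of models `S[t] ⊆ E` and their local rings
`locAtCentre S[t] O_E`:

> Let `B′ = S[t′]` and `B ⊆ (S[t′])_𝔪` be models inside `O_E` with `B` integrally closed in the common
> fraction field `K` (every element of `K` is a fraction of elements of `B`), `N := locAtCentre B`
> and `S′ := locAtCentre B′` their local rings (`N ⊆ S′`). If every prime ideal of `S′`
> containing `𝔪_N` is `𝔪_{S′}` ("`√(𝔪_N S′) = 𝔪_{S′}`", e.g. from (52)) and the residue field
> of `O_E` is algebraic over that of `S`, THEN `S′ = N`.

(`locAtCentre_le_locAtCentre_of_forall_isPrime`). This is Mathlib's algebraic ZMT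
(`Algebra.ZariskisMainProperty`, Stacks 00Q9) through the tree's birational local form
`bijective_algebraMap_of_essFiniteType_of_forall_isPrime` (`NormalBirationalQuasiFinite.lean`):
`S′` is essentially of finite type over `N` (a localization of `N[t′]`), birational
(`Frac N = K ⊇ S′`), the inclusion is local, and the residue field of `S′` is algebraic over
that of `N` because both sit in the residue field of `O_E`, algebraic over that of `S`.

Everything is PROVED; no named facts, definitions, instances or notation are introduced.

## Sources

* V. Cossart, O. Piltant, J. Algebra 320 (2008) 1051–1082: proof of Prop. 9.3, last
  paragraph (HAL hal-00139124, p. 28). [CossartPiltant2008]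
* V. Cossart, O. Piltant, J. Algebra 529 (2019) = arXiv:1412.0868, proof of Prop. 4.6,
  "so `𝒪_{Ŷ,ŷ} = T′_{P′}`" (arXiv v1 p. 53). [CossartPiltant2019]
* The Stacks Project, Tag 00Q9. [StacksProject]
-/

noncomputable section

open IsLocalRing Polynomial

namespace Literature.AlgebraicGeometry.Resolution

universe u

variable {S : Type u} [CommRing S] [IsLocalRing S] {E : Type u} [Field E] [Algebra S E]

set_option maxHeartbeats 800000 in
/-- **[CoP1] Prop. 9.3: "`R` lies below `S′`" (Zariski's Main Theorem), in the frame.** See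
the module docstring. Data: `O` a valuation ring of `E` containing `S` with residue field
algebraic over that of `S` (`hres`); models `S[t′]` and `B ⊆ locAtCentre S[t′] O` in `O`; `K` a subfield containing `S`
and `t′` all of whose elements are fractions of elements of `B`, with `B` integrally closed in
`K`. Hypothesis `hrad`: every prime ideal of `S′ = locAtCentre S[t′] O` containing all elements
of `S′` which lie in `N = locAtCentre B O` and have positive value is the maximal ideal.
Conclusion: `S′ ⊆ N` (hence `S′ = N`).
[cite: CossartPiltant2008, proof of Prop. 9.3, last paragraph (HAL p. 28)]
[cite: CossartPiltant2019, proof of Prop. 4.6 (arXiv v1 p. 53)] [cite: StacksProject, Tag 00Q9] -/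
theorem locAtCentre_le_locAtCentre_of_forall_isPrime
    (O : ValuationSubring E) (hSO : ∀ s : S, algebraMap S E s ∈ O)
    (hres : ∀ y : O, ∃ q : S[X], (∃ i, q.coeff i ∉ maximalIdeal S) ∧
      O.valuation (q.eval₂ (algebraMap S E) y) < 1)
    (B : Subalgebra S E) (hBO : B.toSubring ≤ O.toSubring)
    (t' : Finset E) (hB'O : (Algebra.adjoin S (t' : Set E)).toSubring ≤ O.toSubring)
    (hBS' : B.toSubring ≤ locAtCentre (Algebra.adjoin S (t' : Set E)).toSubring O)
    (K : Subfield E) (hSK : ∀ s : S, algebraMap S E s ∈ K) (ht'K : (t' : Set E) ⊆ K)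
    (hKB : ∀ z ∈ K, ∃ a ∈ B.toSubring, ∃ b ∈ B.toSubring, b ≠ 0 ∧ z = a / b)
    (hnormB : ∀ x ∈ K, IsIntegral B x → x ∈ B)
    (hrad : ∀ P : Ideal (locAtCentre (Algebra.adjoin S (t' : Set E)).toSubring O), P.IsPrime →
      (∀ y : locAtCentre (Algebra.adjoin S (t' : Set E)).toSubring O,
        (y : E) ∈ locAtCentre B.toSubring O → O.valuation (y : E) < 1 → y ∈ P) →
      (haveI := isLocalRing_locAtCentre hB'O
       P = maximalIdeal (locAtCentre (Algebra.adjoin S (t' : Set E)).toSubring O))) :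
    locAtCentre (Algebra.adjoin S (t' : Set E)).toSubring O ≤ locAtCentre B.toSubring O := by
  classical
  set B' : Subalgebra S E := Algebra.adjoin S (t' : Set E) with hB'def
  set N : Subring E := locAtCentre B.toSubring O with hNdef
  set S' : Subring E := locAtCentre B'.toSubring O with hS'def
  haveI hNloc : IsLocalRing N := isLocalRing_locAtCentre hBO
  haveI hS'loc : IsLocalRing S' := isLocalRing_locAtCentre hB'O
  have hNS' : N ≤ S' := by
    have h := locAtCentre_mono O hBS'
    rwa [locAtCentre_locAtCentre] at h
  have hS'O : S' ≤ O.toSubring := locAtCentre_le hB'O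
  have hNO : N ≤ O.toSubring := locAtCentre_le hBO
  -- `B′ ⊆ K`, `B ⊆ S′ ⊆ K`, `N ⊆ S′`
  have hB'K : B'.toSubring ≤ K.toSubring := model_toSubring_le_of_subset hSK ht'K
  have hS'K : S' ≤ K.toSubring := locAtCentre_le_subfield B'.toSubring O K hB'K
  have hBK : B.toSubring ≤ K.toSubring := hBS'.trans hS'K
  have hNK : N ≤ K.toSubring := hNS'.trans hS'K
  -- `N` is an integrally closed local domain with fraction field `K`
  haveI : IsIntegrallyClosed N :=
    isIntegrallyClosed_locAtCentre B.toSubring K hBK hKB (fun x hx hint => hnormB x hx hint) O hBO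
  letI : Algebra N S' := (Subring.inclusion hNS').toAlgebra
  letI : Algebra N K := (Subring.inclusion hNK).toAlgebra
  letI : Algebra S' K := (Subring.inclusion hS'K).toAlgebra
  haveI : IsScalarTower N S' K := IsScalarTower.of_algebraMap_eq fun _ => rfl
  have hNKinj : Function.Injective (algebraMap N K) := fun a b hab => by
    apply Subtype.ext
    have := congrArg (fun z : K => (z : E)) hab
    exact this
  haveI : FaithfulSMul N K := (faithfulSMul_iff_algebraMap_injective N K).mpr hNKinj
  haveI : IsFractionRing N K := by
    refine IsFractionRing.of_field N K fun z => ?_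
    obtain ⟨a, ha, b, hb, -, hz⟩ := hKB z z.2
    exact ⟨⟨a, le_locAtCentre _ _ ha⟩, ⟨b, le_locAtCentre _ _ hb⟩, Subtype.ext hz⟩
  have hS'Kinj : Function.Injective (algebraMap S' K) := fun a b hab => by
    apply Subtype.ext
    have := congrArg (fun z : K => (z : E)) hab
    exact this
  -- the inclusion `N → S′` is local
  haveI : IsLocalHom (algebraMap N S') := by
    refine ⟨fun a ha => ?_⟩
    by_contra hna
    have hva : O.valuation (a : E) < 1 := (not_isUnit_locAtCentre_iff hBO a).mp hna
    have : ¬ IsUnit (algebraMap N S' a) := (not_isUnit_locAtCentre_iff hB'O _).mpr hva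
    exact this ha
  -- `S′` is essentially of finite type over `N`: a localization of `N[t′]`
  let φ : S →+* N := (algebraMap S E).codRestrict N
    (fun s => le_locAtCentre _ _ (B.algebraMap_mem s))
  have hφE : ∀ s : S, ((φ s : N) : E) = algebraMap S E s := fun _ => rfl
  haveI : Algebra.EssFiniteType N S' := by
    rw [Algebra.essFiniteType_iff]
    let σ : Finset S' := t'.attach.image
      (fun x => (⟨x.1, le_locAtCentre _ _ (Algebra.subset_adjoin (Finset.mem_coe.mpr x.2))⟩ : S'))
    refine ⟨σ, fun s => ?_⟩
    -- `B′ ⊆` (image of `N[σ]` in `E`)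
    let C : Subring E := (Algebra.adjoin N (σ : Set S')).toSubring.map S'.subtype
    have hB'C : B'.toSubring ≤ C := by
      refine model_toSubring_le_of_subset (fun r => ?_) (fun x hx => ?_)
      · refine ⟨algebraMap N S' (φ r), Subalgebra.algebraMap_mem _ _, ?_⟩
        rfl
      · have hxσ : (⟨x, le_locAtCentre _ _ (Algebra.subset_adjoin hx)⟩ : S') ∈ σ :=
          Finset.mem_image.mpr ⟨⟨x, Finset.mem_coe.mp hx⟩, Finset.mem_attach _ _, rfl⟩
        exact ⟨_, Algebra.subset_adjoin (Finset.mem_coe.mpr hxσ), rfl⟩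
    have hmemC : ∀ y : E, ∀ hy : y ∈ B'.toSubring,
        (⟨y, le_locAtCentre _ _ hy⟩ : S') ∈ Algebra.adjoin N (σ : Set S') := by
      intro y hy
      obtain ⟨w, hw, hwy⟩ := hB'C hy
      have : w = ⟨y, le_locAtCentre _ _ hy⟩ := Subtype.ext hwy
      rw [← this]
      exact hw
    obtain ⟨y, hy, w, hw, hvw, hs⟩ := s.2
    refine ⟨⟨w, le_locAtCentre _ _ hw⟩, hmemC w hw, ?_, ?_⟩
    · have : ¬ O.valuation ((⟨w, le_locAtCentre _ _ hw⟩ : S') : E) < 1 := by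
        change ¬ O.valuation w < 1
        rw [hvw]; exact lt_irrefl _
      by_contra hnu
      exact this ((not_isUnit_locAtCentre_iff hB'O _).mp hnu)
    · have : s * ⟨w, le_locAtCentre _ _ hw⟩ = ⟨y, le_locAtCentre _ _ hy⟩ := by
        apply Subtype.ext
        change (s : E) * w = y
        rw [hs, div_mul_cancel₀ _ (ne_zero_of_valuation_eq_one hvw)]
      rw [this]
      exact hmemC y hy
  -- the two hypotheses of the birational ZMT
  have hrad' : ∀ P : Ideal S', P.IsPrime → (maximalIdeal N).map (algebraMap N S') ≤ P →
      P = maximalIdeal S' := by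
    intro P hP hle
    refine hrad P hP (fun y hyN hvy => ?_)
    have hmem : (⟨(y : E), hyN⟩ : N) ∈ maximalIdeal N :=
      (mem_maximalIdeal_locAtCentre_iff hBO _).mpr hvy
    have := hle (Ideal.mem_map_of_mem (algebraMap N S') hmem)
    have heq : algebraMap N S' ⟨(y : E), hyN⟩ = y := Subtype.ext rfl
    rwa [heq] at this
  have halg : ∀ x : S', ∃ p : N[X], (∃ i, p.coeff i ∉ maximalIdeal N) ∧
      p.eval₂ (algebraMap N S') x ∈ maximalIdeal S' := by
    intro x
    obtain ⟨q, ⟨i, hi⟩, hv⟩ := hres ⟨x, hS'O x.2⟩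
    refine ⟨q.map φ, ⟨i, ?_⟩, ?_⟩
    · rw [Polynomial.coeff_map]
      intro hmem
      have hv1 : O.valuation ((φ (q.coeff i) : N) : E) < 1 :=
        (mem_maximalIdeal_locAtCentre_iff hBO _).mp hmem
      rw [hφE] at hv1
      apply hi
      by_contra hni
      have hu : IsUnit (q.coeff i) := by
        by_contra hnu
        exact hni ((IsLocalRing.mem_maximalIdeal _).mpr hnu)
      obtain ⟨c, hc⟩ := hu.exists_right_inv
      have h1 : O.valuation (algebraMap S E (q.coeff i)) = 1 :=
        valuation_eq_one_of_mul_eq_one O (hSO _) (hSO c) (by rw [← map_mul, hc, map_one])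
      rw [h1] at hv1
      exact lt_irrefl _ hv1
    · rw [Polynomial.eval₂_map, mem_maximalIdeal_locAtCentre_iff hB'O]
      have : ((q.eval₂ ((algebraMap N S').comp φ) x : S') : E) =
          q.eval₂ (algebraMap S E) (x : E) := by
        rw [show ((q.eval₂ ((algebraMap N S').comp φ) x : S') : E) =
            S'.subtype (q.eval₂ ((algebraMap N S').comp φ) x) from rfl, Polynomial.hom_eval₂]
        rfl
      rw [this]
      exact hv
  have hbij := bijective_algebraMap_of_essFiniteType_of_forall_isPrime (N := N) (S := S') (K := K)
    hS'Kinj hrad' halg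
  intro z hz
  obtain ⟨a, ha⟩ := hbij.2 ⟨z, hz⟩
  have : (a : E) = z := congrArg (fun w : S' => (w : E)) ha
  rw [← this]
  exact a.2

end Literature.AlgebraicGeometry.Resolution

end
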